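import Summits.FinalStateConjecture.FinalStateConjecture.Theorems.EIHFluxBalanceInertialRecessionStubRechart3PointBound

/-!
# Route EIHFluxBalance — `InertialRecession`, re-charting: late windows and the slab-point bound

Helper file for the crux `stmt-FinalStateConjecture-10166`
(`Summit.FinalStateConjecture.FinalStateConjecture.Theses.EIHFluxBalance.InertialRecession`),
line `sublinear-is-free-clean-window-charges`, stub `stub_rechart` (the transfer P2), part G1.

* `exists_window` — from the decay of the derivatives of the normalised frame and of the centre
  mismatch, for every `δ > 0` a lab time `S` after which all fifteen frame/centre quantities entering
  the chart estimates are `≤ δ`;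
* `norm_iteratedFDeriv_deviation_slabPoint_le` — the pointwise `C²` bound of the rest-frame clock
  chart at a slab point `y` (`y⁰ = τ`, `‖ỹ‖ ≤ R`) in terms of the window size `δ`, the lab deviation
  `η₁` and the other summands `η₂`: `≤ 32 D⁴ η₁ + 30 C_K (6000 γ⁵ (1+R)⁶ δ) + N · 32 D⁴ η₂`,
  `D = 640 γ⁴ (1+R)⁴` (composition of `…ChartBounds`, `…FrameDefect`, `…PointBound`). [folklore]
-/

noncomputable section

set_option linter.dupNamespace false

open Set Filter Function Metric Topology TopologicalSpace
open scoped ContDiff Manifold ENNReal BigOperators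
open Literature.Geometry.Lorentzian

namespace Summit.FinalStateConjecture.FinalStateConjecture.Theorems.SublinearIsFree.Rechart

/-! ### Late windows -/

/-- A function tending to `0` is eventually of norm `≤ δ`. [folklore] -/
theorem eventually_norm_le_of_tendsto {F : Type*} [NormedAddCommGroup F] {f : ℝ → F}
    (h : Tendsto f atTop (𝓝 0)) {δ : ℝ} (hδ : 0 < δ) : ∀ᶠ s in atTop, ‖f s‖ ≤ δ := by
  have := (tendsto_iff_norm_sub_tendsto_zero.mp h)
  simp only [sub_zero] at this
  filter_upwards [(tendsto_order.mp this).2 δ hδ] with s hs using hs.le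

/-- The time component of the iterated derivatives of the frame velocity. [folklore] -/
theorem iteratedDeriv_frameVel_zero (Λ : ℝ → lorentzGroup)
    (hΛ : ContDiff ℝ ∞ (fun t ↦ ((Λ t : E4 ≃L[ℝ] E4) : E4 →L[ℝ] E4))) (m : ℕ) (t : ℝ) :
    iteratedDeriv m (fun s ↦ frameVel (Λ s) 0) t = iteratedDeriv m (fun s ↦ frameVel (Λ s)) t 0 := by
  have h := iteratedDeriv_clm_comp (EuclideanSpace.proj (0 : Fin 4) : E4 →L[ℝ] ℝ) (contDiff_frameVel Λ hΛ) m t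
  exact h

/-- **Late windows.** For every `δ > 0` there is a lab time `S` after which the derivatives of
`u⁰` (orders 1, 2), of the tilt `ℓ` and the purged frame `M` (orders 1, 2, 3), of the inverse frame
(orders 1, 2), the centre mismatch `c' − u/u⁰` and `c'', c'''` are all of norm `≤ δ`. [folklore] -/
theorem exists_window (Λ : ℝ → lorentzGroup) (ξ : ℝ → E3)
    (hΛ : ContDiff ℝ ∞ (fun t ↦ ((Λ t : E4 ≃L[ℝ] E4) : E4 →L[ℝ] E4)))
    (hdec : ∀ m, 1 ≤ m → m ≤ 3 → Tendsto (fun t ↦ iteratedDeriv m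
      (fun s ↦ ((Λ s : E4 ≃L[ℝ] E4) : E4 →L[ℝ] E4)) t) atTop (𝓝 0))
    {γ : ℝ} (hγ : ∀ t, |((Λ t : E4 ≃L[ℝ] E4) (E4.basisVector 0)) 0| ≤ γ)
    (hpos : ∀ t, 0 < ((Λ t : E4 ≃L[ℝ] E4) (E4.basisVector 0)) 0) (hξ : ContDiff ℝ ∞ ξ)
    (hmis : ∀ m : ℕ, m ≤ 2 → Tendsto (fun t ↦ iteratedDeriv m (fun s ↦ deriv ξ s -
      ((((Λ s : E4 ≃L[ℝ] E4) (E4.basisVector 0)) 0)⁻¹ •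
        E4.spatial ((Λ s : E4 ≃L[ℝ] E4) (E4.basisVector 0)))) t) atTop (𝓝 0))
    {δ : ℝ} (hδ : 0 < δ) :
    ∃ S : ℝ, (∀ s, S ≤ s → ‖deriv (fun t ↦ frameVel (Λ t) 0) s‖ ≤ δ) ∧
      (∀ s, S ≤ s → ‖iteratedDeriv 2 (fun t ↦ frameVel (Λ t) 0) s‖ ≤ δ) ∧
      (∀ s, S ≤ s → ‖deriv (fun t ↦ frameTilt (Λ t)) s‖ ≤ δ) ∧
      (∀ s, S ≤ s → ‖iteratedDeriv 2 (fun t ↦ frameTilt (Λ t)) s‖ ≤ δ) ∧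
      (∀ s, S ≤ s → ‖iteratedDeriv 3 (fun t ↦ frameTilt (Λ t)) s‖ ≤ δ) ∧
      (∀ s, S ≤ s → ‖deriv (fun t ↦ purgedFrame (Λ t)) s‖ ≤ δ) ∧
      (∀ s, S ≤ s → ‖iteratedDeriv 2 (fun t ↦ purgedFrame (Λ t)) s‖ ≤ δ) ∧
      (∀ s, S ≤ s → ‖iteratedDeriv 3 (fun t ↦ purgedFrame (Λ t)) s‖ ≤ δ) ∧
      (∀ s, S ≤ s → ‖deriv (centrePath ξ) s - normVel (Λ s)‖ ≤ δ) ∧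
      (∀ s, S ≤ s → ‖iteratedDeriv 2 (centrePath ξ) s‖ ≤ δ) ∧
      (∀ s, S ≤ s → ‖iteratedDeriv 3 (centrePath ξ) s‖ ≤ δ) ∧
      (∀ s, S ≤ s → ‖deriv (fun t ↦ (((Λ t : E4 ≃L[ℝ] E4).symm : E4 ≃L[ℝ] E4) : E4 →L[ℝ] E4)) s‖ ≤ δ) ∧
      (∀ s, S ≤ s →
        ‖iteratedDeriv 2 (fun t ↦ (((Λ t : E4 ≃L[ℝ] E4).symm : E4 ≃L[ℝ] E4) : E4 →L[ℝ] E4)) s‖ ≤ δ) := by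
  -- the individual decays
  have hu : ∀ m, 1 ≤ m → m ≤ 3 → Tendsto (fun t ↦ iteratedDeriv m (fun s ↦ frameVel (Λ s) 0) t) atTop (𝓝 0) := by
    intro m hm1 hm3
    have h := tendsto_iteratedDeriv_frameVel Λ hΛ hdec m hm1 hm3
    have h' := ((EuclideanSpace.proj (0 : Fin 4) : E4 →L[ℝ] ℝ).continuous.tendsto 0).comp h
    rw [map_zero] at h'
    refine h'.congr fun t ↦ ?_
    simp only [Function.comp_apply]
    exact (iteratedDeriv_frameVel_zero Λ hΛ m t).symm
  have hL := tendsto_iteratedDeriv_frameTilt Λ hΛ hdec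
  have hP := tendsto_iteratedDeriv_purgedFrame Λ hΛ hdec hγ hpos
  have hc := tendsto_iteratedDeriv_centreMismatch hξ Λ hΛ hmis 0 (by norm_num)
  have hcc := tendsto_iteratedDeriv_centrePath hξ Λ hΛ hdec hγ hpos hmis
  have hF := tendsto_iteratedDeriv_lorentz_symm Λ hΛ hdec hγ
  simp only [iteratedDeriv_zero] at hc
  -- eventual bounds
  have e1 := eventually_norm_le_of_tendsto (hu 1 le_rfl (by norm_num)) hδ
  have e2 := eventually_norm_le_of_tendsto (hu 2 (by norm_num) (by norm_num)) hδ
  have e3 := eventually_norm_le_of_tendsto (hL 1 le_rfl (by norm_num)) hδ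
  have e4 := eventually_norm_le_of_tendsto (hL 2 (by norm_num) (by norm_num)) hδ
  have e5 := eventually_norm_le_of_tendsto (hL 3 (by norm_num) le_rfl) hδ
  have e6 := eventually_norm_le_of_tendsto (hP 1 le_rfl (by norm_num)) hδ
  have e7 := eventually_norm_le_of_tendsto (hP 2 (by norm_num) (by norm_num)) hδ
  have e8 := eventually_norm_le_of_tendsto (hP 3 (by norm_num) le_rfl) hδ
  have e9 := eventually_norm_le_of_tendsto hc hδ
  have e10 := eventually_norm_le_of_tendsto (hcc 1 le_rfl (by norm_num)) hδ
  have e11 := eventually_norm_le_of_tendsto (hcc 2 (by norm_num) le_rfl) hδ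
  have e12 := eventually_norm_le_of_tendsto (hF 1 le_rfl (by norm_num)) hδ
  have e13 := eventually_norm_le_of_tendsto (hF 2 (by norm_num) (by norm_num)) hδ
  have eall := ((((((((((((e1.and e2).and e3).and e4).and e5).and e6).and e7).and e8).and e9).and e10).and e11).and e12).and e13)
  obtain ⟨S, hS⟩ := eventually_atTop.mp eall
  refine ⟨S, fun s hs ↦ ?_, fun s hs ↦ ?_, fun s hs ↦ ?_, fun s hs ↦ ?_, fun s hs ↦ ?_, fun s hs ↦ ?_,
    fun s hs ↦ ?_, fun s hs ↦ ?_, fun s hs ↦ ?_, fun s hs ↦ ?_, fun s hs ↦ ?_, fun s hs ↦ ?_, fun s hs ↦ ?_⟩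
  · have h := (hS s hs).1.1.1.1.1.1.1.1.1.1.1.1; rwa [iteratedDeriv_one] at h
  · exact (hS s hs).1.1.1.1.1.1.1.1.1.1.1.2
  · have h := (hS s hs).1.1.1.1.1.1.1.1.1.1.2; rwa [iteratedDeriv_one] at h
  · exact (hS s hs).1.1.1.1.1.1.1.1.1.2
  · exact (hS s hs).1.1.1.1.1.1.1.1.2
  · have h := (hS s hs).1.1.1.1.1.1.1.2; rwa [iteratedDeriv_one] at h
  · exact (hS s hs).1.1.1.1.1.1.2
  · exact (hS s hs).1.1.1.1.1.2
  · exact (hS s hs).1.1.1.1.2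
  · exact (hS s hs).1.1.1.2
  · exact (hS s hs).1.1.2
  · have h := (hS s hs).1.2; rwa [iteratedDeriv_one] at h
  · exact (hS s hs).2

/-! ### The slab-point bound -/

section SlabPoint

variable (𝓢 : Spacetime 4) {N : ℕ} (i : Fin N) (M a : Fin N → ℝ) (Λ : Fin N → ℝ → lorentzGroup)
  (ξ : Fin N → ℝ → E3) (Λt : ℝ → lorentzGroup) (T₀ : ℝ → ℝ)
  (hbil : ∀ t x, boostedKerrBilin (Λt t) (E4.ofTimeSpace t (ξ i t)) (M i) (a i) x =
    boostedKerrBilin (Λ i t) (E4.ofTimeSpace t (ξ i t)) (M i) (a i) x)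
  (hrad : ∀ t x, Kerr.radius (a i) (poincareInv (Λt t) (E4.ofTimeSpace t (ξ i t)) x) =
    Kerr.radius (a i) (poincareInv (Λ i t) (E4.ofTimeSpace t (ξ i t)) x))
  {H : Fin N → E4 → E4 →L[ℝ] E4 →L[ℝ] ℝ}
  (hH : ∀ j z, H j z = boostedKerrBilin (Λ j (z 0)) (E4.ofTimeSpace (z 0) (ξ j (z 0))) (M j) (a j) z -
    Minkowski.bilin)
  {Bb : E4 → E4 →L[ℝ] E4 →L[ℝ] ℝ} (hBb : ∀ z, Bb z = Minkowski.bilin + ∑ j, H j z)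
  (hΛ : ∀ j, ContDiff ℝ ∞ (fun t ↦ ((Λ j t : E4 ≃L[ℝ] E4) : E4 →L[ℝ] E4)))
  (hξ : ∀ j, ContDiff ℝ ∞ (ξ j))
  (hΛt : ContDiff ℝ ∞ (fun t ↦ ((Λt t : E4 ≃L[ℝ] E4) : E4 →L[ℝ] E4))) (hT₀ : ContDiff ℝ ∞ T₀)
  (hclock : ∀ τ, HasDerivAt T₀ (frameVel (Λt (T₀ τ)) 0) τ)
  {γ : ℝ} (hγ1 : 1 ≤ γ) (hu1 : ∀ t, 1 ≤ frameVel (Λt t) 0)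
  (huγ : ∀ t, |((Λt t : E4 ≃L[ℝ] E4) (E4.basisVector 0)) 0| ≤ γ)
  {S δ : ℝ} (hδ0 : 0 ≤ δ) (hδ1 : δ ≤ 1)
  (hu' : ∀ s, S ≤ s → ‖deriv (fun t ↦ frameVel (Λt t) 0) s‖ ≤ δ)
  (hu'' : ∀ s, S ≤ s → ‖iteratedDeriv 2 (fun t ↦ frameVel (Λt t) 0) s‖ ≤ δ)
  (hL' : ∀ s, S ≤ s → ‖deriv (fun t ↦ frameTilt (Λt t)) s‖ ≤ δ)
  (hL'' : ∀ s, S ≤ s → ‖iteratedDeriv 2 (fun t ↦ frameTilt (Λt t)) s‖ ≤ δ)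
  (hL''' : ∀ s, S ≤ s → ‖iteratedDeriv 3 (fun t ↦ frameTilt (Λt t)) s‖ ≤ δ)
  (hP' : ∀ s, S ≤ s → ‖deriv (fun t ↦ purgedFrame (Λt t)) s‖ ≤ δ)
  (hP'' : ∀ s, S ≤ s → ‖iteratedDeriv 2 (fun t ↦ purgedFrame (Λt t)) s‖ ≤ δ)
  (hP''' : ∀ s, S ≤ s → ‖iteratedDeriv 3 (fun t ↦ purgedFrame (Λt t)) s‖ ≤ δ)
  (hc' : ∀ s, S ≤ s → ‖deriv (centrePath (ξ i)) s - normVel (Λt s)‖ ≤ δ)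
  (hc'' : ∀ s, S ≤ s → ‖iteratedDeriv 2 (centrePath (ξ i)) s‖ ≤ δ)
  (hc''' : ∀ s, S ≤ s → ‖iteratedDeriv 3 (centrePath (ξ i)) s‖ ≤ δ)
  (hF' : ∀ s, S ≤ s → ‖deriv (fun t ↦ (((Λt t : E4 ≃L[ℝ] E4).symm : E4 ≃L[ℝ] E4) : E4 →L[ℝ] E4)) s‖ ≤ δ)
  (hF'' : ∀ s, S ≤ s →
    ‖iteratedDeriv 2 (fun t ↦ (((Λt t : E4 ≃L[ℝ] E4).symm : E4 ≃L[ℝ] E4) : E4 →L[ℝ] E4)) s‖ ≤ δ)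
  (U : Opens E4) (Φ : U → 𝓢.carrier) (hΦ : ContMDiff 𝓘(ℝ, E4) (𝓡 4) ∞ Φ)
  {A : E4 → E4} (hAc : ContDiff ℝ ∞ A)
  (hAU : ∀ y ∈ boostedKerrExterior 1 0 (M i) (a i), A y ∈ U)
  {Ψ₁ : boostedKerrExterior 1 0 (M i) (a i) → 𝓢.carrier}
  (hΨ₁ : ∀ y, Ψ₁ y = Φ ⟨A y.1, hAU y.1 y.2⟩)

include hbil hrad hH hBb hΛ hξ hΛt hT₀ hclock hγ1 hu1 huγ hδ0 hδ1 hu' hu'' hL' hL'' hL''' hP' hP'' hP''' hc'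
  hc'' hc''' hF' hF'' hΦ hAc hΨ₁ in
-- long chain of `C²` bookkeeping
set_option maxHeartbeats 800000 in
/-- **The slab-point bound.** At a point `y` of the rest exterior with `y⁰ = τ`, `‖ỹ‖ ≤ R`, after a
`δ`-window (`S + 4γR ≤ T₀(τ − 1)`, `6000 γ⁵ (1+R)⁶ δ ≤ 1`), near which `A` is the honest chart:
`‖Dᵐ (Ψ₁^* g − g_{M,a})(y)‖ ≤ 32 D⁴ η₁ + 30 C_K (6000 γ⁵ (1+R)⁶ δ) + N · 32 D⁴ η₂`, `D = 640 γ⁴ (1+R)⁴`,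
for `m ≤ 2`. [folklore] -/
theorem norm_iteratedFDeriv_deviation_slabPoint_le {R τ : ℝ} (hR : 0 ≤ R)
    (hS : S + 4 * γ * R ≤ T₀ (τ - 1)) (hδε : 6000 * γ ^ 5 * (1 + R) ^ 6 * δ ≤ 1)
    {y : E4} (hy : y ∈ Kerr.exterior (M i) (a i)) (hy0 : y 0 = τ) (hyR : ‖E4.spatial y‖ ≤ R)
    (hAeq : A =ᶠ[𝓝 y] honestChart Λt (ξ i) T₀) {CK η₁ η₂ : ℝ}
    (hCK : ∀ j ≤ 2, ‖iteratedFDeriv ℝ j (Kerr.bilin (M i) (a i)) y‖ ≤ CK) (hη₁ : 0 ≤ η₁) (hη₂ : 0 ≤ η₂)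
    (hoth : ∀ j ≠ i, 0 < Kerr.radius (a j) (poincareInv (Λ j (honestChart Λt (ξ i) T₀ y 0))
        (E4.ofTimeSpace (honestChart Λt (ξ i) T₀ y 0) (ξ j (honestChart Λt (ξ i) T₀ y 0)))
        (honestChart Λt (ξ i) T₀ y)) ∧
      ∀ l ≤ 2, ‖iteratedFDeriv ℝ l (H j) (honestChart Λt (ξ i) T₀ y)‖ ≤ η₂)
    (hyU : honestChart Λt (ξ i) T₀ y ∈ U)
    (hdevb : ∀ l ≤ 2, ‖iteratedFDeriv ℝ l
      (𝓢.deviationExtend ⟨U, Bb, fun z ↦ z 0, E4.spatialNorm⟩ Φ) (honestChart Λt (ξ i) T₀ y)‖ ≤ η₁) :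
    ∀ m ≤ 2, ‖iteratedFDeriv ℝ m (𝓢.deviationExtend (boostedKerrBackground 1 0 (M i) (a i)) Ψ₁) y‖ ≤
      32 * (640 * γ ^ 4 * (1 + R) ^ 4) ^ 4 * η₁ + 30 * CK * (6000 * γ ^ 5 * (1 + R) ^ 6 * δ) +
        N * (32 * (640 * γ ^ 4 * (1 + R) ^ 4) ^ 4 * η₂) := by
  set ρ : ℝ := 1 + R with hρ
  have hρ1 : 1 ≤ ρ := by rw [hρ]; linarith
  have hγ0 : 0 ≤ γ := by linarith
  have hmono : Monotone T₀ :=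
    (strictMono_of_deriv_pos fun x ↦ by rw [(hclock x).deriv]; linarith [hu1 (T₀ x)]).monotone
  have hy0' : |y 0 - τ| ≤ 1 := by rw [hy0, sub_self, abs_zero]; exact zero_le_one
  have hS1 : S + 4 * γ * R ≤ T₀ (y 0) := by
    rw [hy0]; exact hS.trans (hmono (by linarith))
  -- derivative bounds of the honest chart at `y`
  obtain ⟨b2, b3⟩ := norm_iteratedFDeriv_honestChart_le Λt (ξ i) T₀ hΛt (hξ i) hT₀ hclock hγ1 hu1 huγ hδ0 hδ1
    hu' hu'' hL' hL'' hL''' hP' hP'' hP''' hc' hc'' hc''' hR hyR hS1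
  have b1 := norm_fderiv_honestChart_sub_frame_le Λt (ξ i) T₀ hΛt (hξ i) hT₀ hclock hγ1 hu1 huγ hδ0 hδ1
    hu' hu'' hL' hL'' hL''' hP' hP'' hP''' hc' hc'' hc''' hR hmono hS hy0' hyR
  set D : ℝ := 640 * γ ^ 4 * ρ ^ 4 with hD
  have m := fun (a b c d : ℕ) (hab : a ≤ b) (hcd : c ≤ d) ↦ monomial_mono hγ1 hρ1 zero_le_one hab hcd
  have hγρ : 1 ≤ γ ^ 4 * ρ ^ 4 := one_le_mul_of_one_le_of_one_le (one_le_pow₀ hγ1) (one_le_pow₀ hρ1)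
  have hD1 : 1 ≤ D := by rw [hD]; nlinarith
  have hDb : ∀ j, 1 ≤ j → j ≤ 3 → ‖iteratedFDeriv ℝ j (honestChart Λt (ξ i) T₀) y‖ ≤ D := by
    intro j hj1 hj3
    interval_cases j
    · rw [← norm_iteratedFDeriv_fderiv, norm_iteratedFDeriv_zero]
      have h1 : ‖fderiv ℝ (honestChart Λt (ξ i) T₀) y‖ ≤
          ‖fderiv ℝ (honestChart Λt (ξ i) T₀) y - ((Λt (T₀ τ) : E4 ≃L[ℝ] E4) : E4 →L[ℝ] E4)‖ +
            ‖((Λt (T₀ τ) : E4 ≃L[ℝ] E4) : E4 →L[ℝ] E4)‖ := norm_le_norm_sub_add _ _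
      have h2 := norm_frame_le_four_mul Λt huγ (T₀ τ)
      have h3 : 83 * γ ^ 3 * (1 + R) ^ 4 * δ ≤ 83 * (γ ^ 4 * ρ ^ 4 * 1) := by
        have := m 3 4 4 4 (by norm_num) le_rfl
        have h' : γ ^ 3 * ρ ^ 4 * δ ≤ γ ^ 3 * ρ ^ 4 * 1 :=
          mul_le_mul_of_nonneg_left hδ1 (by positivity)
        rw [hρ] at this h' ⊢; nlinarith
      have h4 : 4 * γ ≤ 4 * (γ ^ 4 * ρ ^ 4 * 1) := by
        have := m 1 4 0 4 (by norm_num) (by norm_num)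
        simp only [pow_one, pow_zero, mul_one] at this ⊢; linarith
      rw [hD]; linarith
    · have h3 : 78 * γ ^ 3 * (1 + R) ^ 3 * δ ≤ 78 * (γ ^ 4 * ρ ^ 4 * 1) := by
        have := m 3 4 3 4 (by norm_num) (by norm_num)
        have h' : γ ^ 3 * ρ ^ 3 * δ ≤ γ ^ 3 * ρ ^ 3 * 1 :=
          mul_le_mul_of_nonneg_left hδ1 (by positivity)
        rw [hρ] at this h' ⊢; nlinarith
      rw [hD]; linarith
    · have h3 : 472 * γ ^ 4 * (1 + R) ^ 4 * δ ≤ 472 * (γ ^ 4 * ρ ^ 4 * 1) := by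
        have h' : γ ^ 4 * ρ ^ 4 * δ ≤ γ ^ 4 * ρ ^ 4 * 1 :=
          mul_le_mul_of_nonneg_left hδ1 (by positivity)
        rw [hρ] at h' ⊢; nlinarith
      rw [hD]; linarith
  -- the frame defect at `y`
  have hEb := norm_iteratedFDeriv_frameDefect_le Λt (ξ i) T₀ hΛt (hξ i) hT₀ hclock hγ1 hu1 huγ hδ0 hδ1 hu'
    hu'' hL' hL'' hL''' hP' hP'' hP''' hc' hc'' hc''' hF' hF'' hR hmono hS hy0' hyR
  have hε0 : 0 ≤ 6000 * γ ^ 5 * (1 + R) ^ 6 * δ := by positivity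
  have h := norm_iteratedFDeriv_deviation_clockChart_le 𝓢 i M a Λ ξ Λt T₀ hbil hrad hH hBb hΛ hξ hΛt hT₀ U Φ
    hΦ hAc hAU hΨ₁ hy hAeq hD1 hDb hCK hε0 hδε hEb hη₁ hη₂ hoth hyU hdevb
  rw [hD, hρ] at h
  exact h

end SlabPoint

/-- Registered one-line form (worker carrier `rechart_eventually_norm_le_of_tendsto`). [folklore] -/
theorem rechart_eventually_norm_le_of_tendsto : open Filter Topology in ∀ {F : Type*} [NormedAddCommGroup F] {f : ℝ → F}, Tendsto f atTop (𝓝 0) → ∀ {δ : ℝ}, 0 < δ → ∀ᶠ s in atTop, ‖f s‖ ≤ δ := fun h _ hδ ↦ eventually_norm_le_of_tendsto h hδ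

end Summit.FinalStateConjecture.FinalStateConjecture.Theorems.SublinearIsFree.Rechart

end
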